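import Summits.Schanuel.Schanuel.Theorems.SoloInformedRankTwoCensus
import Literature.Barriers.Schanuel.LargeTranscendenceDegreeThm29Holds
import Literature.Barriers.Schanuel.NesterenkoModularScope
import Literature.NumberTheory.Transcendental.CalegariDimitrovTangL2Chi3Reduction

/-!
# The ladder at `(1, πi)`: what is proved around `e, π, e^{π²}` and the first open rung

Soloist file (`solo-Schanuel-informed`, 2026-08-18, s3). Bookkeeping over transcendence theorems
PROVED in the tree (Brownawell–Waldschmidt `brownawell_waldschmidt`; the `2 × 3` small
transcendence degree theorem `two_le_trdeg_gridField₂`); no new transcendence input.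

The pair `(1, πi)` is the first `ℚ`-independent pair outside the rank-two census
(`SoloInformedRankTwoCensus.lean`): Schanuel's inequality there is EXACTLY `e ⟂ π`
(`two_le_trdeg_expField_one_piI_iff`), and at the neighbouring pair `(πi, π²)` exactly
`π ⟂ e^{π²}` (`two_le_trdeg_expField_piI_piSq_iff`) — both printed open [cite: BakerTNT1975,
Ch. 12 §1 p. 119] [cite: Waldschmidt2004, §3]. What IS proved, and the weakest open statement:

* (R0a, dichotomy) `expOnePiAlgebraicIndependent_of_isAlgebraic_exp_pi_sq`: if `e^{π²}` is
  algebraic then `e, π` are algebraically independent — Brownawell–Waldschmidt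
  [cite: BakerTNT1975, Ch. 12 Theorem 12.2] at `x = y = (πi, 1)` (the algebraic row is
  `e^{−π²}, e^{πi} = −1`); equivalently `e ⟂ π ∨ e^{π²} ∉ ℚ̄`
  (`expOnePiAlgebraicIndependent_or_transcendental_exp_pi_sq`). This is Corollary 1.9 of
  [cite: Chudnovsky1984, Ch. 7 §1], the only unconditional statement printed at this pair.
* (R0b, one number more) `two_le_trdeg_adjoin_e_pi_expPiSq_expPiCubeI`:
  `2 ≤ trdeg ℚ(e, π, e^{π²}, e^{iπ³})` — the `2 × 3` case `x = (1, πi)`, `y = (1, πi, π²)` of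
  [cite: NesterenkoPhilippon2001, Ch. 14 Theorem 2.9] (`ℓ + d = 5 < 6 = dℓ`).
* (R1, OPEN) `TwoOfEPiExpPiSq`: `2 ≤ trdeg ℚ(e, π, e^{π²})` — "two of `e, π, e^{π²}` are
  algebraically independent". Implied by each of the two rank-two instances
  (`twoOfEPiExpPiSq_of_expOnePiAlgebraicIndependent`, `…_of_algebraicIndependent_pi_expPiSq`);
  true if `e^{π²}` is algebraic (R0a), so its open content is the case `e^{π²}` transcendental
  (`twoOfEPiExpPiSq_iff`); it is the `2 × 2` configuration `x = y = (1, πi)` with NO algebraic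
  row — one algebraic exponential (`e^{−π²}`) short of Brownawell–Waldschmidt, one exponential
  (`e^{iπ³}`) short of Theorem 2.9: the corner `t = 3, μ₃ = 2(d₁ + ℓ₁)` excluded from
  [cite: RoyWaldschmidt1997ENS, Corollaire 1.2 (c)].
-/

noncomputable section

open Complex IntermediateField
open Literature.NumberTheory.Transcendental (ExpOnePiAlgebraicIndependent SchanuelRank)
open Literature.Barriers.Schanuel (trdeg_mono trdeg_adjoin_union_eq_of_isAlgebraic
  algebraicIndependent_of_le_trdeg_adjoin algebraicIndependent_real_of_complex isAlgebraic_I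
  linearIndependent_one_piI linearIndependent_piI_pi_sq two_le_trdeg_gridField₂)

namespace Summit.Schanuel.Schanuel.Theorems

/-! ### Auxiliary: pairs of real numbers, generated fields, linear independence -/

/-- For real `a, b`: `2 ≤ trdeg ℚ(a, b)` (computed in `ℂ`) iff `a, b` are algebraically
independent (in `ℝ`). -/
theorem two_le_trdeg_adjoin_pair_iff (a b : ℝ) :
    (2 : Cardinal) ≤ Algebra.trdeg ℚ ↥(adjoin ℚ ({(a : ℂ), (b : ℂ)} : Set ℂ)) ↔
      AlgebraicIndependent ℚ ![a, b] := by
  have hr : Set.range (fun i => ((![a, b] i : ℝ) : ℂ)) = {(a : ℂ), (b : ℂ)} := by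
    ext w
    simp only [Set.mem_range, Set.mem_insert_iff, Set.mem_singleton_iff]
    constructor
    · rintro ⟨i, rfl⟩; fin_cases i <;> simp
    · rintro (rfl | rfl); exacts [⟨0, by simp⟩, ⟨1, by simp⟩]
  refine ⟨fun h => ?_, fun h => ?_⟩
  · refine algebraicIndependent_real_of_complex _ (algebraicIndependent_of_le_trdeg_adjoin _ ?_)
    rw [hr]; exact_mod_cast h
  · have hC : AlgebraicIndependent ℚ (fun i => ((![a, b] i : ℝ) : ℂ)) :=
      h.map' (f := Complex.ofRealAm.restrictScalars ℚ) Complex.ofReal_injective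
    have h2 := Literature.Barriers.Schanuel.natCast_le_trdeg_of_algebraicIndependent
      (L := adjoin ℚ ({(a : ℂ), (b : ℂ)} : Set ℂ)) hC
      (fun i => subset_adjoin ℚ _ (by rw [← hr]; exact ⟨i, rfl⟩))
    exact_mod_cast h2

/-- If all generators of a grid field `ℚ(x, y, e^{xᵢyⱼ})` lie in `F`, the field is `≤ F`. -/
theorem adjoin_grid_le {d l : ℕ} {x : Fin d → ℂ} {y : Fin l → ℂ} {F : IntermediateField ℚ ℂ}
    (hx : ∀ i, x i ∈ F) (hy : ∀ j, y j ∈ F) (hxy : ∀ i j, cexp (x i * y j) ∈ F) :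
    adjoin ℚ (Set.range x ∪ Set.range y ∪
      Set.range (fun p : Fin d × Fin l => cexp (x p.1 * y p.2))) ≤ F := by
  rw [adjoin_le_iff]
  rintro w ((⟨i, rfl⟩ | ⟨j, rfl⟩) | ⟨p, rfl⟩)
  exacts [hx i, hy j, hxy p.1 p.2]

/-- `πi, 1` are `ℚ`-linearly independent. -/
theorem linearIndependent_piI_one : LinearIndependent ℚ ![(Real.pi : ℂ) * I, (1 : ℂ)] := by
  have h := linearIndependent_one_piI.comp ![(1 : Fin 2), 0] (by decide)
  convert h using 1
  funext i
  fin_cases i <;> rfl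

/-- `1, πi, π²` are `ℚ`-linearly independent (imaginary parts; `π²` is irrational). -/
theorem linearIndependent_one_piI_piSq :
    LinearIndependent ℚ ![(1 : ℂ), (Real.pi : ℂ) * I, ((Real.pi ^ 2 : ℝ) : ℂ)] := by
  refine Fintype.linearIndependent_iff.mpr fun g hg => ?_
  rw [Fin.sum_univ_three] at hg
  simp only [Matrix.cons_val_zero, Matrix.cons_val_one, Matrix.cons_val_two, Matrix.head_cons,
    Matrix.tail_cons] at hg
  have hre := congrArg Complex.re hg
  have him := congrArg Complex.im hg
  simp only [Complex.add_re, Complex.add_im, Complex.mul_re, Complex.mul_im, Complex.ofReal_re,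
    Complex.ofReal_im, Complex.I_re, Complex.I_im, Complex.zero_re, Complex.zero_im, mul_zero,
    mul_one, sub_zero, add_zero, zero_add, Rat.smul_def, Complex.ratCast_re, Complex.ratCast_im,
    zero_mul] at hre him
  have h02 :=
    Literature.NumberTheory.Transcendental.CalegariDimitrovTang.eq_zero_of_add_mul_pi_sq_eq_zero
      (g 0) (g 2) (by linarith)
  have h1 : g 1 = 0 := by
    have : (g 1 : ℝ) * Real.pi = 0 := by linarith
    rcases mul_eq_zero.mp this with h | h
    · exact_mod_cast h
    · exact absurd h Real.pi_ne_zero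
  intro i; fin_cases i; exacts [h02.1, h1, h02.2]

/-- `(πi)(πi) = −π²`. -/
theorem piI_mul_piI : (Real.pi : ℂ) * I * ((Real.pi : ℂ) * I) = -((Real.pi : ℂ) ^ 2) := by
  rw [mul_mul_mul_comm, Complex.I_mul_I]; ring

/-- `e^{π²}` algebraic (real) ⟹ `e^{−π²}` algebraic (complex). -/
theorem isAlgebraic_exp_neg_pi_sq (h : IsAlgebraic ℚ (Real.exp (Real.pi ^ 2))) :
    IsAlgebraic ℚ (cexp (-((Real.pi : ℂ) ^ 2))) := by
  have hpos : IsAlgebraic ℚ (cexp ((Real.pi : ℂ) ^ 2)) := by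
    rw [← Complex.ofReal_pow, ← Complex.ofReal_exp]; exact h.algebraMap
  rw [Complex.exp_neg]; exact hpos.inv

/-! ### R0a — the Brownawell–Waldschmidt dichotomy at `(1, πi)` -/

/-- **R0a.** If `e^{π²}` is algebraic then `e` and `π` are algebraically independent
(Brownawell 1974 / Waldschmidt 1973: `x = y = (πi, 1)`, algebraic row `e^{−π²}, −1`; the field
`ℚ(πi, 1, e^{−π²}, −1, −1, e)` lies in `ℚ(e, π)(i, e^{−π²})`, an algebraic extension). -/
theorem expOnePiAlgebraicIndependent_of_isAlgebraic_exp_pi_sq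
    (h : IsAlgebraic ℚ (Real.exp (Real.pi ^ 2))) : ExpOnePiAlgebraicIndependent := by
  have hneg := isAlgebraic_exp_neg_pi_sq h
  have hbw := Literature.NumberTheory.Transcendental.BrownawellWaldschmidt.brownawell_waldschmidt
    ![(Real.pi : ℂ) * I, 1] ![(Real.pi : ℂ) * I, 1] linearIndependent_piI_one
    linearIndependent_piI_one
    (show IsAlgebraic ℚ (cexp ((Real.pi : ℂ) * I * ((Real.pi : ℂ) * I))) by
      rw [piI_mul_piI]; exact hneg)
    (show IsAlgebraic ℚ (cexp ((Real.pi : ℂ) * I * 1)) by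
      rw [mul_one, Complex.exp_pi_mul_I]; exact isAlgebraic_one.neg)
  set S : Set ℂ := {((Real.exp 1 : ℝ) : ℂ), (Real.pi : ℂ)} with hS
  set T : Set ℂ := {I, cexp (-((Real.pi : ℂ) ^ 2))} with hT
  set F : IntermediateField ℚ ℂ := adjoin ℚ (S ∪ T) with hF
  have he : cexp 1 ∈ F := by
    rw [show cexp 1 = ((Real.exp 1 : ℝ) : ℂ) by rw [Complex.ofReal_exp, Complex.ofReal_one]]
    exact subset_adjoin ℚ _ (Or.inl (by simp [hS]))
  have hpi : (Real.pi : ℂ) ∈ F := subset_adjoin ℚ _ (Or.inl (by simp [hS]))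
  have hI : I ∈ F := subset_adjoin ℚ _ (Or.inr (by simp [hT]))
  have hn : cexp (-((Real.pi : ℂ) ^ 2)) ∈ F := subset_adjoin ℚ _ (Or.inr (by simp [hT]))
  have hpiI : (Real.pi : ℂ) * I ∈ F := mul_mem hpi hI
  have hm1 : cexp ((Real.pi : ℂ) * I) ∈ F := by
    rw [Complex.exp_pi_mul_I]; exact neg_mem (one_mem F)
  have g00 : cexp ((Real.pi : ℂ) * I * ((Real.pi : ℂ) * I)) ∈ F := by rw [piI_mul_piI]; exact hn
  have g01 : cexp ((Real.pi : ℂ) * I * 1) ∈ F := by rw [mul_one]; exact hm1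
  have g10 : cexp (1 * ((Real.pi : ℂ) * I)) ∈ F := by rw [one_mul]; exact hm1
  have g11 : cexp ((1 : ℂ) * 1) ∈ F := by rw [mul_one]; exact he
  have hle := adjoin_grid_le (x := ![(Real.pi : ℂ) * I, 1]) (y := ![(Real.pi : ℂ) * I, 1]) (F := F)
    (Fin.forall_fin_two.mpr ⟨hpiI, one_mem F⟩) (Fin.forall_fin_two.mpr ⟨hpiI, one_mem F⟩)
    (Fin.forall_fin_two.mpr
      ⟨Fin.forall_fin_two.mpr ⟨g00, g01⟩, Fin.forall_fin_two.mpr ⟨g10, g11⟩⟩)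
  have hT' : ∀ t ∈ T, IsAlgebraic ℚ t := by
    rintro t (rfl | rfl); exacts [isAlgebraic_I, hneg]
  have h2S : (2 : Cardinal) ≤ Algebra.trdeg ℚ ↥(adjoin ℚ S) :=
    (hbw.trans (trdeg_mono hle)).trans_eq (trdeg_adjoin_union_eq_of_isAlgebraic S T hT')
  exact (two_le_trdeg_adjoin_pair_iff (Real.exp 1) Real.pi).mp h2S

/-- **The dichotomy** (Chudnovsky's Corollary 1.9): `e, π` algebraically independent, or `e^{π²}`
transcendental — unconditionally. -/
theorem expOnePiAlgebraicIndependent_or_transcendental_exp_pi_sq :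
    ExpOnePiAlgebraicIndependent ∨ Transcendental ℚ (Real.exp (Real.pi ^ 2)) := by
  by_cases h : IsAlgebraic ℚ (Real.exp (Real.pi ^ 2))
  exacts [Or.inl (expOnePiAlgebraicIndependent_of_isAlgebraic_exp_pi_sq h), Or.inr h]

/-! ### R0b — the `2 × 3` rung -/

/-- **R0b.** `2 ≤ trdeg ℚ(e, π, e^{π²}, e^{iπ³})`: Theorem 2.9 at `x = (1, πi)`,
`y = (1, πi, π²)`; the grid exponentials are `e, −1, e^{π²}, −1, e^{−π²}, e^{iπ³}`, and `i` is
algebraic. -/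
theorem two_le_trdeg_adjoin_e_pi_expPiSq_expPiCubeI :
    (2 : Cardinal) ≤ Algebra.trdeg ℚ ↥(adjoin ℚ ({cexp 1, (Real.pi : ℂ), cexp ((Real.pi : ℂ) ^ 2),
      cexp ((Real.pi : ℂ) ^ 3 * I)} : Set ℂ)) := by
  have hgrid := two_le_trdeg_gridField₂ ![(1 : ℂ), (Real.pi : ℂ) * I]
    ![(1 : ℂ), (Real.pi : ℂ) * I, ((Real.pi ^ 2 : ℝ) : ℂ)] linearIndependent_one_piI
    linearIndependent_one_piI_piSq (by norm_num)
  set S : Set ℂ :=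
    {cexp 1, (Real.pi : ℂ), cexp ((Real.pi : ℂ) ^ 2), cexp ((Real.pi : ℂ) ^ 3 * I)} with hS
  set F : IntermediateField ℚ ℂ := adjoin ℚ (S ∪ {I}) with hF
  have he : cexp 1 ∈ F := subset_adjoin ℚ _ (Or.inl (by simp [hS]))
  have hpi : (Real.pi : ℂ) ∈ F := subset_adjoin ℚ _ (Or.inl (by simp [hS]))
  have h2 : cexp ((Real.pi : ℂ) ^ 2) ∈ F := subset_adjoin ℚ _ (Or.inl (by simp [hS]))
  have h3 : cexp ((Real.pi : ℂ) ^ 3 * I) ∈ F := subset_adjoin ℚ _ (Or.inl (by simp [hS]))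
  have hI : I ∈ F := subset_adjoin ℚ _ (Or.inr rfl)
  have hpiI : (Real.pi : ℂ) * I ∈ F := mul_mem hpi hI
  have hsq : ((Real.pi ^ 2 : ℝ) : ℂ) ∈ F := by rw [Complex.ofReal_pow]; exact pow_mem hpi 2
  have hm1 : cexp ((Real.pi : ℂ) * I) ∈ F := by
    rw [Complex.exp_pi_mul_I]; exact neg_mem (one_mem F)
  have g00 : cexp ((1 : ℂ) * 1) ∈ F := by rw [mul_one]; exact he
  have g01 : cexp (1 * ((Real.pi : ℂ) * I)) ∈ F := by rw [one_mul]; exact hm1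
  have g02 : cexp (1 * ((Real.pi ^ 2 : ℝ) : ℂ)) ∈ F := by
    rw [one_mul, Complex.ofReal_pow]; exact h2
  have g10 : cexp ((Real.pi : ℂ) * I * 1) ∈ F := by rw [mul_one]; exact hm1
  have g11 : cexp ((Real.pi : ℂ) * I * ((Real.pi : ℂ) * I)) ∈ F := by
    rw [piI_mul_piI, Complex.exp_neg]; exact inv_mem h2
  have g12 : cexp ((Real.pi : ℂ) * I * ((Real.pi ^ 2 : ℝ) : ℂ)) ∈ F := by
    rw [show (Real.pi : ℂ) * I * ((Real.pi ^ 2 : ℝ) : ℂ) = (Real.pi : ℂ) ^ 3 * I by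
      push_cast; ring]
    exact h3
  have hle : Literature.Barriers.Schanuel.gridField₂ ![(1 : ℂ), (Real.pi : ℂ) * I]
      ![(1 : ℂ), (Real.pi : ℂ) * I, ((Real.pi ^ 2 : ℝ) : ℂ)] ≤ F :=
    adjoin_grid_le (F := F) (Fin.forall_fin_two.mpr ⟨one_mem F, hpiI⟩)
      (fun j => by fin_cases j; exacts [one_mem F, hpiI, hsq])
      (Fin.forall_fin_two.mpr ⟨fun j => by fin_cases j; exacts [g00, g01, g02],
        fun j => by fin_cases j; exacts [g10, g11, g12]⟩)
  have hIalg : ∀ t ∈ ({I} : Set ℂ), IsAlgebraic ℚ t := by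
    intro t ht; rw [Set.mem_singleton_iff.mp ht]; exact isAlgebraic_I
  exact (hgrid.trans (trdeg_mono hle)).trans_eq (trdeg_adjoin_union_eq_of_isAlgebraic S {I} hIalg)

/-! ### The two rank-two instances of Schanuel's conjecture adjacent to R1 -/

/-- `trdeg ℚ(1, πi, e, e^{πi}) = trdeg ℚ(e, π)`: both fields become `ℚ(e, π, i)` after
adjoining the algebraic number `i`. -/
theorem trdeg_expField_one_piI_eq :
    Algebra.trdeg ℚ ↥(expField ![(1 : ℂ), (Real.pi : ℂ) * I]) =
      Algebra.trdeg ℚ ↥(adjoin ℚ ({((Real.exp 1 : ℝ) : ℂ), (Real.pi : ℂ)} : Set ℂ)) := by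
  set A : Set ℂ := Set.range ![(1 : ℂ), (Real.pi : ℂ) * I] ∪
    Set.range (cexp ∘ ![(1 : ℂ), (Real.pi : ℂ) * I]) with hA
  set S : Set ℂ := {((Real.exp 1 : ℝ) : ℂ), (Real.pi : ℂ)} with hS
  have hIalg : ∀ t ∈ ({I} : Set ℂ), IsAlgebraic ℚ t := by
    intro t ht; rw [Set.mem_singleton_iff.mp ht]; exact isAlgebraic_I
  have hexp1 : cexp 1 = ((Real.exp 1 : ℝ) : ℂ) := by rw [Complex.ofReal_exp, Complex.ofReal_one]
  have hAS : adjoin ℚ (A ∪ {I}) = adjoin ℚ (S ∪ {I}) := by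
    apply le_antisymm
    · have he : ((Real.exp 1 : ℝ) : ℂ) ∈ adjoin ℚ (S ∪ {I}) :=
        subset_adjoin ℚ _ (Or.inl (by simp [hS]))
      have hpi : (Real.pi : ℂ) ∈ adjoin ℚ (S ∪ {I}) := subset_adjoin ℚ _ (Or.inl (by simp [hS]))
      have hI : I ∈ adjoin ℚ (S ∪ {I}) := subset_adjoin ℚ _ (Or.inr rfl)
      rw [adjoin_le_iff]
      rintro w ((⟨i, rfl⟩ | ⟨i, rfl⟩) | hw)
      · fin_cases i; exacts [one_mem _, mul_mem hpi hI]
      · fin_cases i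
        · show cexp 1 ∈ adjoin ℚ (S ∪ {I}); rw [hexp1]; exact he
        · show cexp ((Real.pi : ℂ) * I) ∈ adjoin ℚ (S ∪ {I})
          rw [Complex.exp_pi_mul_I]; exact neg_mem (one_mem _)
      · rw [Set.mem_singleton_iff.mp hw]; exact hI
    · have hpiI : (Real.pi : ℂ) * I ∈ adjoin ℚ (A ∪ {I}) :=
        subset_adjoin ℚ _ (Or.inl (Or.inl ⟨1, rfl⟩))
      have he : cexp 1 ∈ adjoin ℚ (A ∪ {I}) := subset_adjoin ℚ _ (Or.inl (Or.inr ⟨0, rfl⟩))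
      have hI : I ∈ adjoin ℚ (A ∪ {I}) := subset_adjoin ℚ _ (Or.inr rfl)
      rw [adjoin_le_iff]
      rintro w (hw | hw)
      · simp only [hS, Set.mem_insert_iff, Set.mem_singleton_iff] at hw
        rcases hw with rfl | rfl
        · rw [← hexp1]; exact he
        · rw [show (Real.pi : ℂ) = -((Real.pi : ℂ) * I * I) by
            rw [mul_assoc, Complex.I_mul_I]; ring]
          exact neg_mem (mul_mem hpiI hI)
      · rw [Set.mem_singleton_iff.mp hw]; exact hI
  calc Algebra.trdeg ℚ ↥(expField ![(1 : ℂ), (Real.pi : ℂ) * I])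
      = Algebra.trdeg ℚ ↥(adjoin ℚ A) := rfl
    _ = Algebra.trdeg ℚ ↥(adjoin ℚ (A ∪ {I})) :=
        (trdeg_adjoin_union_eq_of_isAlgebraic A {I} hIalg).symm
    _ = Algebra.trdeg ℚ ↥(adjoin ℚ (S ∪ {I})) := (equivOfEq hAS).trdeg_eq
    _ = Algebra.trdeg ℚ ↥(adjoin ℚ S) := trdeg_adjoin_union_eq_of_isAlgebraic S {I} hIalg

/-- **Schanuel's inequality at `(1, πi)` is the algebraic independence of `e` and `π`.** -/
theorem two_le_trdeg_expField_one_piI_iff :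
    (2 : Cardinal) ≤ Algebra.trdeg ℚ ↥(expField ![(1 : ℂ), (Real.pi : ℂ) * I]) ↔
      ExpOnePiAlgebraicIndependent := by
  rw [trdeg_expField_one_piI_eq]
  exact two_le_trdeg_adjoin_pair_iff (Real.exp 1) Real.pi

/-- Rank two of Schanuel's conjecture already gives `e ⟂ π` (sharper hypothesis than the
tree's `expOnePiAlgebraicIndependent_of_schanuel`, which assumes all ranks). -/
theorem expOnePiAlgebraicIndependent_of_schanuelRank_two (h : SchanuelRank 2) :
    ExpOnePiAlgebraicIndependent :=
  two_le_trdeg_expField_one_piI_iff.mp (h _ linearIndependent_one_piI)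

/-- `trdeg ℚ(πi, π², e^{πi}, e^{π²}) = trdeg ℚ(π, e^{π²})` (adjoin the algebraic number `i`). -/
theorem trdeg_expField_piI_piSq_eq :
    Algebra.trdeg ℚ ↥(expField ![(Real.pi : ℂ) * I, ((Real.pi ^ 2 : ℝ) : ℂ)]) =
      Algebra.trdeg ℚ
        ↥(adjoin ℚ ({(Real.pi : ℂ), ((Real.exp (Real.pi ^ 2) : ℝ) : ℂ)} : Set ℂ)) := by
  set A : Set ℂ := Set.range ![(Real.pi : ℂ) * I, ((Real.pi ^ 2 : ℝ) : ℂ)] ∪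
    Set.range (cexp ∘ ![(Real.pi : ℂ) * I, ((Real.pi ^ 2 : ℝ) : ℂ)]) with hA
  set S : Set ℂ := {(Real.pi : ℂ), ((Real.exp (Real.pi ^ 2) : ℝ) : ℂ)} with hS
  have hIalg : ∀ t ∈ ({I} : Set ℂ), IsAlgebraic ℚ t := by
    intro t ht; rw [Set.mem_singleton_iff.mp ht]; exact isAlgebraic_I
  have hexp : cexp ((Real.pi ^ 2 : ℝ) : ℂ) = ((Real.exp (Real.pi ^ 2) : ℝ) : ℂ) := by
    rw [Complex.ofReal_exp]
  have hAS : adjoin ℚ (A ∪ {I}) = adjoin ℚ (S ∪ {I}) := by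
    apply le_antisymm
    · have hpi : (Real.pi : ℂ) ∈ adjoin ℚ (S ∪ {I}) := subset_adjoin ℚ _ (Or.inl (by simp [hS]))
      have he : ((Real.exp (Real.pi ^ 2) : ℝ) : ℂ) ∈ adjoin ℚ (S ∪ {I}) :=
        subset_adjoin ℚ _ (Or.inl (by simp [hS]))
      have hI : I ∈ adjoin ℚ (S ∪ {I}) := subset_adjoin ℚ _ (Or.inr rfl)
      rw [adjoin_le_iff]
      rintro w ((⟨i, rfl⟩ | ⟨i, rfl⟩) | hw)
      · fin_cases i
        · exact mul_mem hpi hI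
        · show ((Real.pi ^ 2 : ℝ) : ℂ) ∈ adjoin ℚ (S ∪ {I})
          rw [Complex.ofReal_pow]; exact pow_mem hpi 2
      · fin_cases i
        · show cexp ((Real.pi : ℂ) * I) ∈ adjoin ℚ (S ∪ {I})
          rw [Complex.exp_pi_mul_I]; exact neg_mem (one_mem _)
        · show cexp ((Real.pi ^ 2 : ℝ) : ℂ) ∈ adjoin ℚ (S ∪ {I}); rw [hexp]; exact he
      · rw [Set.mem_singleton_iff.mp hw]; exact hI
    · have hpiI : (Real.pi : ℂ) * I ∈ adjoin ℚ (A ∪ {I}) :=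
        subset_adjoin ℚ _ (Or.inl (Or.inl ⟨0, rfl⟩))
      have he : cexp ((Real.pi ^ 2 : ℝ) : ℂ) ∈ adjoin ℚ (A ∪ {I}) :=
        subset_adjoin ℚ _ (Or.inl (Or.inr ⟨1, rfl⟩))
      have hI : I ∈ adjoin ℚ (A ∪ {I}) := subset_adjoin ℚ _ (Or.inr rfl)
      rw [adjoin_le_iff]
      rintro w (hw | hw)
      · simp only [hS, Set.mem_insert_iff, Set.mem_singleton_iff] at hw
        rcases hw with rfl | rfl
        · rw [show (Real.pi : ℂ) = -((Real.pi : ℂ) * I * I) by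
            rw [mul_assoc, Complex.I_mul_I]; ring]
          exact neg_mem (mul_mem hpiI hI)
        · rw [← hexp]; exact he
      · rw [Set.mem_singleton_iff.mp hw]; exact hI
  calc Algebra.trdeg ℚ ↥(expField ![(Real.pi : ℂ) * I, ((Real.pi ^ 2 : ℝ) : ℂ)])
      = Algebra.trdeg ℚ ↥(adjoin ℚ A) := rfl
    _ = Algebra.trdeg ℚ ↥(adjoin ℚ (A ∪ {I})) :=
        (trdeg_adjoin_union_eq_of_isAlgebraic A {I} hIalg).symm
    _ = Algebra.trdeg ℚ ↥(adjoin ℚ (S ∪ {I})) := (equivOfEq hAS).trdeg_eq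
    _ = Algebra.trdeg ℚ ↥(adjoin ℚ S) := trdeg_adjoin_union_eq_of_isAlgebraic S {I} hIalg

/-- **Schanuel's inequality at `(πi, π²)` is the algebraic independence of `π` and `e^{π²}`**
(printed open; it contains the transcendence of `e^{π²}` [cite: Waldschmidt2005Periodes, §8.1
Exemple 26]). -/
theorem two_le_trdeg_expField_piI_piSq_iff :
    (2 : Cardinal) ≤ Algebra.trdeg ℚ ↥(expField ![(Real.pi : ℂ) * I, ((Real.pi ^ 2 : ℝ) : ℂ)]) ↔
      AlgebraicIndependent ℚ ![Real.pi, Real.exp (Real.pi ^ 2)] := by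
  rw [trdeg_expField_piI_piSq_eq]
  exact two_le_trdeg_adjoin_pair_iff Real.pi (Real.exp (Real.pi ^ 2))

/-- Rank two of Schanuel's conjecture gives `π ⟂ e^{π²}`. -/
theorem algebraicIndependent_pi_expPiSq_of_schanuelRank_two (h : SchanuelRank 2) :
    AlgebraicIndependent ℚ ![Real.pi, Real.exp (Real.pi ^ 2)] :=
  two_le_trdeg_expField_piI_piSq_iff.mp (h _ linearIndependent_piI_pi_sq)

/-! ### R1 — the first open rung below both instances -/

/-- OPEN (R1): **two of `e, π, e^{π²}` are algebraically independent**, i.e.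
`2 ≤ trdeg ℚ(e, π, e^{π²})`. The `2 × 2` configuration `x = y = (1, πi)` without algebraic row;
not in print as a theorem ([cite: Chudnovsky1984, Ch. 7 §1 Corollary 1.9] is the dichotomy R0a;
[cite: RoyWaldschmidt1997ENS, Corollaire 1.2] excludes `t = 3, μ₃ = 2(d₁ + ℓ₁)` without
algebraic row). Implied by `SchanuelRank 2` (`twoOfEPiExpPiSq_of_schanuelRank_two`). -/
@[conjecture] def TwoOfEPiExpPiSq : Prop :=
  (2 : Cardinal) ≤ Algebra.trdeg ℚ ↥(adjoin ℚ
    ({cexp 1, (Real.pi : ℂ), cexp ((Real.pi : ℂ) ^ 2)} : Set ℂ))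

/-- `e ⟂ π ⟹ R1` (monotonicity of `trdeg` in the generated field). -/
theorem twoOfEPiExpPiSq_of_expOnePiAlgebraicIndependent (h : ExpOnePiAlgebraicIndependent) :
    TwoOfEPiExpPiSq := by
  have h2 := (two_le_trdeg_adjoin_pair_iff (Real.exp 1) Real.pi).mpr h
  rw [Complex.ofReal_exp, Complex.ofReal_one] at h2
  exact h2.trans (trdeg_mono (adjoin.mono ℚ _ _
    (Set.insert_subset_insert (Set.singleton_subset_iff.mpr (Set.mem_insert _ _)))))

/-- `π ⟂ e^{π²} ⟹ R1`, and then `e^{π²}` is transcendental. -/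
theorem twoOfEPiExpPiSq_of_algebraicIndependent_pi_expPiSq
    (h : AlgebraicIndependent ℚ ![Real.pi, Real.exp (Real.pi ^ 2)]) :
    TwoOfEPiExpPiSq ∧ Transcendental ℚ (Real.exp (Real.pi ^ 2)) := by
  refine ⟨?_, by simpa using h.transcendental 1⟩
  have h2 := (two_le_trdeg_adjoin_pair_iff Real.pi (Real.exp (Real.pi ^ 2))).mpr h
  rw [Complex.ofReal_exp, Complex.ofReal_pow] at h2
  exact h2.trans (trdeg_mono (adjoin.mono ℚ _ _ (Set.subset_insert _ _)))

/-- R1 holds if `e^{π²}` is algebraic (R0a). -/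
theorem twoOfEPiExpPiSq_of_isAlgebraic_exp_pi_sq (h : IsAlgebraic ℚ (Real.exp (Real.pi ^ 2))) :
    TwoOfEPiExpPiSq :=
  twoOfEPiExpPiSq_of_expOnePiAlgebraicIndependent
    (expOnePiAlgebraicIndependent_of_isAlgebraic_exp_pi_sq h)

/-- Unconditionally: R1, or `e^{π²}` is transcendental. -/
theorem twoOfEPiExpPiSq_or_transcendental_exp_pi_sq :
    TwoOfEPiExpPiSq ∨ Transcendental ℚ (Real.exp (Real.pi ^ 2)) :=
  expOnePiAlgebraicIndependent_or_transcendental_exp_pi_sq.imp_left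
    twoOfEPiExpPiSq_of_expOnePiAlgebraicIndependent

/-- The open content of R1 is exactly the case `e^{π²}` transcendental. -/
theorem twoOfEPiExpPiSq_iff :
    TwoOfEPiExpPiSq ↔ (Transcendental ℚ (Real.exp (Real.pi ^ 2)) → TwoOfEPiExpPiSq) := by
  refine ⟨fun h _ => h, fun h => ?_⟩
  by_cases ha : IsAlgebraic ℚ (Real.exp (Real.pi ^ 2))
  exacts [twoOfEPiExpPiSq_of_isAlgebraic_exp_pi_sq ha, h ha]

/-- `SchanuelRank 2 ⟹ R1` (through either adjacent instance; here through `(1, πi)`). -/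
theorem twoOfEPiExpPiSq_of_schanuelRank_two (h : SchanuelRank 2) : TwoOfEPiExpPiSq :=
  twoOfEPiExpPiSq_of_expOnePiAlgebraicIndependent
    (expOnePiAlgebraicIndependent_of_schanuelRank_two h)

/-- The summit implies R1, `e ⟂ π`, `π ⟂ e^{π²}`. -/
theorem twoOfEPiExpPiSq_of_schanuel (h : _root_.Schanuel) :
    TwoOfEPiExpPiSq ∧ ExpOnePiAlgebraicIndependent ∧
      AlgebraicIndependent ℚ ![Real.pi, Real.exp (Real.pi ^ 2)] :=
  ⟨twoOfEPiExpPiSq_of_schanuelRank_two (h 2),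
    expOnePiAlgebraicIndependent_of_schanuelRank_two (h 2),
    algebraicIndependent_pi_expPiSq_of_schanuelRank_two (h 2)⟩

end Summit.Schanuel.Schanuel.Theorems

end
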